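import Summits.AnomalousDissipation.AnomalousDissipation.Theorems.BaireTransferRobustLoudUpgradeLine
import Summits.AnomalousDissipation.AnomalousDissipation.Theorems.BaireTransferRobustLoudUpgradeStubSteadyPersist
import Summits.AnomalousDissipation.AnomalousDissipation.Theorems.BaireTransferRobustLoudUpgradeStubPeriodicWindow
import Summits.AnomalousDissipation.AnomalousDissipation.Theorems.BaireTransferRobustLoudUpgradePeriodicPersistOfHenry
import Literature.Analysis.FluidPDE.PeriodicNSOrbitPersistsProofs
import Literature.Analysis.FluidPDE.LongTimeAverageNonneg

/-!
# Stub `stub_windowExhaust` of the line `malkin-cone-group-orbits`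
# (crux stmt-AnomalousDissipation-1144, `BaireTransfer.RobustLoudUpgrade`, lead c16 reshape:
# lattice-tempered windows)

**Window exhaustion.**  Every loud classical `τ`-periodic witness — a classical solution `u, p` of
`NS_ν(f_c)` on `ℝ × T³` at a viscosity `ν ∈ (0, a)`, `τ`-periodic in time with `τ > 0` — lies in
SOME standard lattice-tempered window `n : ℕ`:
`ν ∈ [a/(n+2), a(n+1)/(n+2)]`, `τ ∈ [1/(n+1), n+1]`, `‖∫ u(0)‖ ≤ n + 1`, and the parabolic moment
`∑_{(m,k)} Λ(m,k)³ ‖û(m,k)‖² ≤ n + 1` of the orbit's space–time Fourier data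
`û = 𝓕(complexify ∘ (timeRoll τ u − ∫ u(0)))` (`Λ(m,k) = |m| + |k|²`).

The only non-elementary input is the rapid decay of `û` for a classical periodic orbit
(`TimePeriodicLattice.orbit_rapidDecay`), which makes every parabolic moment of `Λ û` finite
(`TimePeriodicLattice.moments_of_rapidDecay`); since `Λ · ‖Λ û‖² = Λ³ ‖û‖²` the `Λ³`-moment is
finite, and the six window conditions then hold for every large `n` (archimedean property).

References: G. Iooss, Arch. Rational Mech. Anal. 47 (1972), §2 (space–time Fourier data of
periodic orbits); the vocabulary module `Theorems/BaireTransferRobustLoudUpgradeLine.lean`; the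
lattice suite `Literature/Analysis/FluidPDE/TimePeriodicNSLattice*.lean` and the template
`Literature/Analysis/FluidPDE/PeriodicNSOrbitPersistsProofs.lean` (`persists_main`).
-/

set_option linter.dupNamespace false

noncomputable section

open scoped BigOperators Topology ENNReal NNReal ComplexConjugate
open Filter Set Function TopologicalSpace MeasureTheory UnitAddTorus

namespace Summit.AnomalousDissipation.AnomalousDissipation.Theorems.RobustLoudUpgrade.Tempered

open Literature.Analysis.FunctionSpaces Literature.Analysis.FunctionSpaces.Torus
open Literature.Analysis.FunctionSpaces.EuclideanSpace
open Literature.Analysis.FluidPDE Literature.Analysis.FluidPDE.ScalarFourier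
open Literature.Analysis.FluidPDE.TimePeriodicLattice
open Summit.AnomalousDissipation.AnomalousDissipation.Theses.BaireTransfer
open Summit.AnomalousDissipation.AnomalousDissipation.Theorems.RobustLoudUpgrade

-- NOTATION START (verbatim the local notations of `Literature/Analysis/FluidPDE/PeriodicNSOrbitPersistsProofs.lean`)
/-- The flat unit torus `T³`. -/
local notation "𝕋³" => UnitAddTorus (Fin 3)
/-- Real velocity values. -/
local notation "ℝ³" => EuclideanSpace ℝ (Fin 3)
/-- Complex coefficient values. -/
local notation "ℂ³" => EuclideanSpace ℂ (Fin 3)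

/-- Local notation: the parabolic weight `Λ(n, k) = |n| + |k|²`. -/
local notation:max "Λ" m:max => (|((Prod.fst m : ℤ) : ℝ)| + freqNormSq (Prod.snd m))

/-- Local notation: the convective symbol on `ℤ × ℤ³` (as in `TimePeriodicNSLattice`). -/
local notation:max "𝐍[" a ", " b "]" m:max =>
  (WithLp.toLp 2 (fun p : Fin 3 => ∑ j : Fin 3, ∑' m' : ℤ × (Fin 3 → ℤ),
    a m' j * (dsym j (Prod.snd m - Prod.snd m') * b (m - m') p)) : EuclideanSpace ℂ (Fin 3))

/-- Local notation: division by the weight. -/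
local notation:max "𝐜" x:max => (fun mm : ℤ × (Fin 3 → ℤ) =>
  ((((|((Prod.fst mm : ℤ) : ℝ)| + freqNormSq (Prod.snd mm))⁻¹ : ℝ) : ℂ) • x mm))

/-- Local notation: multiplication by the weight. -/
local notation:max "𝐬" x:max => (fun mm : ℤ × (Fin 3 → ℤ) =>
  ((((|((Prod.fst mm : ℤ) : ℝ)| + freqNormSq (Prod.snd mm)) : ℝ) : ℂ) • x mm))

/-- Local notation: the family of coefficients of `x ∈ W ⊂ ℓ²`. -/
local notation:max "𝐰" x:max =>
  (((x : lp (fun _ : ℤ × (Fin 3 → ℤ) => EuclideanSpace ℂ (Fin 3)) 2)) : ℤ × (Fin 3 → ℤ) → EuclideanSpace ℂ (Fin 3))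

/-- Local notation: the symbol `σ_om(n,k) = 2πi om n + 4π²ν|k|² + 2πi m₀·k`. -/
local notation "σ[" om ", " ν ", " m₀ "]" => (fun mm : ℤ × (Fin 3 → ℤ) =>
  2 * Real.pi * Complex.I * ((om : ℝ) : ℂ) * ((Prod.fst mm : ℤ) : ℂ) +
    (((4 * Real.pi ^ 2 * ν * freqNormSq (Prod.snd mm) : ℝ)) : ℂ) +
    2 * Real.pi * Complex.I * (∑ jj : Fin 3, ((m₀ jj : ℝ) : ℂ) * (((Prod.snd mm) jj : ℤ) : ℂ)))

/-- Local notation: the lattice family of the orbit `u` with period `τ`: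
`û(n,k) = 𝓕(complexify ∘ (timeRoll τ u − ∫ u(0)))(n,k)`. -/
local notation:max "𝐨[" τ ", " u "]" => (fun mm : ℤ × (Fin 3 → ℤ) =>
  mFourierCoeff (EuclideanSpace.complexify ∘ fun y : UnitAddTorus (Fin 4) => Torus.timeRoll τ u y - ∫ x, u 0 x)
    (Fin.cons (Prod.fst mm) (Prod.snd mm) : Fin 4 → ℤ))

/-- Local notation: the force family `y_F(n,k) = [k ≠ 0][n = 0] 𝓕(complexify ∘ F)(k)`. -/
local notation:max "𝐲" F:max => (fun mm : ℤ × (Fin 3 → ℤ) =>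
  (ite (Prod.snd mm = 0) (0 : EuclideanSpace ℂ (Fin 3))
    (ite (Prod.fst mm = 0) (mFourierCoeff (EuclideanSpace.complexify ∘ F) (Prod.snd mm)) 0)))
-- NOTATION END

namespace StubWindowExhaustAux

/-- `Λ · ‖Λ v‖ₑ² = Λ³ ‖v‖ₑ²` for a nonnegative real weight `Λ`. [folklore] -/
theorem ofReal_mul_enorm_smul_sq {r : ℝ} (hr : 0 ≤ r) (v : ℂ³) :
    ENNReal.ofReal (r ^ 1) * ‖((r : ℝ) : ℂ) • v‖ₑ ^ 2 = ENNReal.ofReal (r ^ 3) * ‖v‖ₑ ^ 2 := by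
  rw [enorm_smul, ← ofReal_norm ((r : ℝ) : ℂ), Complex.norm_real, Real.norm_of_nonneg hr, mul_pow,
    ← ENNReal.ofReal_pow hr, ← mul_assoc, ← ENNReal.ofReal_mul (pow_nonneg hr 1), ← pow_add]

/-- The archimedean step: the four scalar window conditions hold for every `n` above the
thresholds `a/ν`, `(2ν − a)/(a − ν)`, `1/τ`, `τ`. [folklore] -/
theorem window_of_thresholds {a ν τ N : ℝ} (hν : 0 < ν) (hνa : ν < a) (hτ : 0 < τ) (hN : 0 ≤ N)
    (hA : a / ν ≤ N) (hB : (2 * ν - a) / (a - ν) ≤ N) (hC : 1 / τ ≤ N) (hD : τ ≤ N) :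
    a / (N + 2) ≤ ν ∧ ν ≤ a * (N + 1) / (N + 2) ∧ 1 / (N + 1) ≤ τ ∧ τ ≤ N + 1 := by
  have hA' : a ≤ N * ν := (div_le_iff₀ hν).1 hA
  have hB' : 2 * ν - a ≤ N * (a - ν) := (div_le_iff₀ (sub_pos.2 hνa)).1 hB
  have hC' : 1 ≤ N * τ := (div_le_iff₀ hτ).1 hC
  refine ⟨?_, ?_, ?_, ?_⟩
  · rw [div_le_iff₀ (by positivity)]
    nlinarith
  · rw [le_div_iff₀ (by positivity)]
    nlinarith
  · rw [div_le_iff₀ (by positivity)]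
    nlinarith
  · linarith

end StubWindowExhaustAux

/-- **Window exhaustion** (Sub₀ of the lattice-tempered reshape): every loud classical `τ`-periodic
witness at a viscosity `ν ∈ (0, a)` lies in some standard lattice-tempered window `n` —
`ν ∈ [a/(n+2), a(n+1)/(n+2)]`, `τ ∈ [1/(n+1), n+1]`, `‖∫ u(0)‖ ≤ n + 1` and
`∑ Λ³ ‖û‖² ≤ n + 1` — because the space–time Fourier data of a classical periodic orbit is
rapidly decaying (Iooss 1972, §2) and the rest is archimedean. [folklore] -/
theorem stub_windowExhaust : ∀ (S : Finset (Fin 3 → ℤ)) (a : ℝ) (c : Coeff S) (ν τ : ℝ)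
    (u : ℝ → 𝕋³ → ℝ³) (p : ℝ → 𝕋³ → ℝ), 0 < ν → ν < a → 0 < τ →
    IsClassicalNSSolutionOn Set.univ ν (fun _ => force S c) u p → Function.Periodic u τ →
    ∃ n : ℕ, a / ((n : ℝ) + 2) ≤ ν ∧ ν ≤ a * ((n : ℝ) + 1) / ((n : ℝ) + 2) ∧
      1 / ((n : ℝ) + 1) ≤ τ ∧ τ ≤ (n : ℝ) + 1 ∧ ‖∫ x, u 0 x‖ ≤ (n : ℝ) + 1 ∧
      (∑' m : ℤ × (Fin 3 → ℤ), ENNReal.ofReal ((Λ m) ^ 3) * ‖𝐨[τ, u] m‖ₑ ^ 2) ≤ ENNReal.ofReal ((n : ℝ) + 1) := by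
  intro S a c ν τ u p hν hνa hτ hsol hper
  -- the `Λ³`-moment of the orbit's lattice data is finite (rapid decay)
  have hur := orbit_rapidDecay hsol hper
  have hM : (∑' m : ℤ × (Fin 3 → ℤ), ENNReal.ofReal ((Λ m) ^ 3) * ‖𝐨[τ, u] m‖ₑ ^ 2) ≠ ⊤ := by
    have h1 : ∑' m : ℤ × (Fin 3 → ℤ), ENNReal.ofReal ((Λ m) ^ 1) * ‖(𝐬 (𝐨[τ, u])) m‖ₑ ^ 2 ≠ ⊤ :=
      moments_of_rapidDecay (C := mFourierCoeff (complexify ∘ fun y => timeRoll τ u y - ∫ x, u 0 x)) hur 1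
    have h2 : (∑' m : ℤ × (Fin 3 → ℤ), ENNReal.ofReal ((Λ m) ^ 3) * ‖𝐨[τ, u] m‖ₑ ^ 2) =
        ∑' m : ℤ × (Fin 3 → ℤ), ENNReal.ofReal ((Λ m) ^ 1) * ‖(𝐬 (𝐨[τ, u])) m‖ₑ ^ 2 :=
      tsum_congr fun m => (StubWindowExhaustAux.ofReal_mul_enorm_smul_sq (wt_nonneg m) _).symm
    rw [h2]
    exact h1
  set M : ℝ≥0∞ := ∑' m : ℤ × (Fin 3 → ℤ), ENNReal.ofReal ((Λ m) ^ 3) * ‖𝐨[τ, u] m‖ₑ ^ 2 with hMdef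
  -- choose `n` above all thresholds
  obtain ⟨n, hn⟩ := exists_nat_ge (max (max (max (a / ν) ((2 * ν - a) / (a - ν))) (max (1 / τ) τ))
    (max ‖∫ x, u 0 x‖ M.toReal))
  simp only [max_le_iff] at hn
  obtain ⟨⟨⟨hA, hB⟩, hC, hD⟩, hE, hF⟩ := hn
  obtain ⟨h₁, h₂, h₃, h₄⟩ :=
    StubWindowExhaustAux.window_of_thresholds hν hνa hτ (Nat.cast_nonneg n) hA hB hC hD
  refine ⟨n, h₁, h₂, h₃, h₄, by linarith, ?_⟩
  rw [← ENNReal.ofReal_toReal hM]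
  exact ENNReal.ofReal_le_ofReal (by linarith)

end Summit.AnomalousDissipation.AnomalousDissipation.Theorems.RobustLoudUpgrade.Tempered

end
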